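import Summits.CriticalPhenomena.PercolationContinuityZ3.Theorems.SubcritExchangeUniformity.Negative.Objects
import Literature.Probability.Percolation.ProdBernoulliRusso

/-!
# `SubcritExchangeUniformity` (K⁻, crux stmt-CriticalPhenomena-16062), negative lane, part 1:
# `∂_tΘ_n(p,t) > 0` for `n ≥ 1`, `p < 1`, `t ∈ (0,1)` — two-parameter Russo and the vertical column

Nothing here asserts a Theses decl; no definitions. Two-parameter Russo in the `t`-direction
(`hasDerivAt_ThetaBox_t`, the tree's `hasDerivAt_prodBernoulli_real` along `s ↦ param p s`:
coordinate derivative `1` on vertical lattice edges, `0` elsewhere — valid for EVERY real `p`),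
bounded below by the term of the first vertical bond `e_z = s(0, e₃)`: on the cylinder "column
`s(k e₃,(k+1) e₃)`, `1 ≤ k < n`, open, every other pair of `Λ_n` closed" the bond `e_z` is pivotal
for `{0 ↔ ∂Λ_n in Λ_n}` (`Column.localCylinder_subset_pivotal`, the `e₃`-copy of the landed
`ModelFacts.stub_pivotalPos` geometry), and that cylinder has positive weight for `p < 1`,
`t ∈ (0,1)` because its open bonds are VERTICAL (`real_localCylinder_pos`) — so positivity of
`∂_tΘ_n` survives on the half-plane `{p ≤ 0}` where `∂_pΘ_n = 0` (`Objects`, §2). The guard `1 ≤ n`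
is needed (`Θ_0 ≡ 1`, cf. `ModelFacts.Negative.DerivPosGuard`).

Tree lemmas used: `hasDerivAt_prodBernoulli_real`, `prodBernoulli_real_localCylinder`,
`Russo.isPivotal_iff_of_notMem`, `DCT16.mem_siteToBoundary_iff`, `DCT16.pathIn_induction`,
`DCT16.notMem_box_of_mem_innerBoundary_box`, `isUpperSet_siteToBoundary`, `determinedBy_siteToBoundary`.
-/

noncomputable section

namespace Summit.CriticalPhenomena.PercolationContinuityZ3.Theorems.SubcritExchangeUniformity.Negative

open MeasureTheory Filter Topology
open Literature.Probability.Percolation Literature.Probability.LatticeModels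
open Literature.Probability.Percolation.DCT16

namespace Column

/-- **Opening `e_z` connects `0` to `∂Λ_n`.** On the cylinder `[colT n]_{Λ_n}`,
`insert e_z ω ∈ {0 ↔ ∂Λ_n in Λ_n}`: the column `0, e₃, …, n e₃` is open and `n e₃ ∈ ∂Λ_n`.
[folklore] -/
theorem insert_mem_siteToBoundary {n : ℕ} {ω : Set (Sym2 (Site 3))}
    (hω : ω ∈ localCylinder (↑((box 3 n).sym2) : Set (Sym2 (Site 3))) (colT n)) :
    insert ez ω ∈ siteToBoundary 3 n := by
  rw [mem_siteToBoundary_iff]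
  refine ⟨Pi.single 2 (n : ℤ), single_mem_innerBoundary n, ?_⟩
  suffices h : ∀ k, k ≤ n →
      PathIn (openGraph (insert ez ω)) ↑(box 3 n) 0 (Pi.single (2 : Fin 3) (k : ℤ)) from h n le_rfl
  intro k
  induction k with
  | zero =>
    intro _
    simp only [Nat.cast_zero, Pi.single_zero]
    exact PathIn.refl (zero_mem_box 3 n)
  | succ k ih =>
    intro hk
    refine (ih (Nat.le_of_succ_le hk)).tail ?_ (single_mem_box hk)
    rw [openGraph_adj]
    refine ⟨?_, (single_adj_single_succ k).ne⟩
    rcases Nat.eq_zero_or_pos k with rfl | hk0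
    · simp [ez]
    · refine Set.mem_insert_of_mem _ ((hω _ ?_).2 ⟨k, hk0, Nat.lt_of_succ_le hk, rfl⟩)
      exact Finset.mk_mem_sym2_iff.2 ⟨single_mem_box (Nat.le_of_succ_le hk), single_mem_box hk⟩

/-- **Without `e_z` the origin is cut off.** On the cylinder `[colT n]_{Λ_n}`, `ω ∉ {0 ↔ ∂Λ_n}`
for `n ≥ 1`: an open path inside `Λ_n` from `0` to `∂Λ_n ∌ 0` starts with an open bond `s(0,u)`,
`u ∈ Λ_n`, which is a pair of `Λ_n`, hence a bond of `colT n` — but those avoid `0`. [folklore] -/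
theorem notMem_siteToBoundary {n : ℕ} (hn : 1 ≤ n) {ω : Set (Sym2 (Site 3))}
    (hω : ω ∈ localCylinder (↑((box 3 n).sym2) : Set (Sym2 (Site 3))) (colT n)) :
    ω ∉ siteToBoundary 3 n := by
  rw [mem_siteToBoundary_iff]
  rintro ⟨y, hy, hpath⟩
  have hy0 : y ≠ 0 := by
    rintro rfl
    exact notMem_box_of_mem_innerBoundary_box (Nat.lt_of_succ_le hn) hy (zero_mem_box 3 0)
  refine hy0 (pathIn_induction (fun z => z = (0 : Site 3)) hpath rfl ?_)
  rintro a b - hb rfl hab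
  exfalso
  have h1 : s((0 : Site 3), b) ∈ ω := ((openGraph_adj ω 0 b).1 hab).1
  have h2 : s((0 : Site 3), b) ∈ (↑((box 3 n).sym2) : Set (Sym2 (Site 3))) :=
    Finset.mk_mem_sym2_iff.2 ⟨zero_mem_box 3 n, hb⟩
  obtain ⟨k, hk1, -, hk⟩ := (hω _ h2).1 h1
  exact zero_notMem_bond hk1 (by rw [← hk]; exact Sym2.mem_mk_left _ _)

/-- **The cylinder `[colT n]_{Λ_n}` lies in `{e_z pivotal for {0 ↔ ∂Λ_n}}`** (`n ≥ 1`). [folklore] -/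
theorem localCylinder_subset_pivotal {n : ℕ} (hn : 1 ≤ n) :
    localCylinder (↑((box 3 n).sym2) : Set (Sym2 (Site 3))) (colT n) ⊆
      {ω | IsPivotal (siteToBoundary 3 n) ez ω} := by
  intro ω hω
  have he : ez ∉ ω := fun h =>
    ez_notMem_colT n ((hω _ (Finset.mem_coe.2 (ez_mem_sym2_box hn))).1 h)
  rw [Set.mem_setOf_eq, Russo.isPivotal_iff_of_notMem (isUpperSet_siteToBoundary 3 n) he]
  exact ⟨insert_mem_siteToBoundary hω, notMem_siteToBoundary hn hω⟩

end Column

/-- The parameters of the family are `< 1` everywhere as soon as `p < 1` and `t < 1`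
(no positivity of `p` needed). [folklore] -/
theorem param_lt_one {p t : ℝ} (hp : p < 1) (ht : t ∈ Set.Ioo (0 : ℝ) 1) (e : Sym2 (Site 3)) :
    (param p t e : ℝ) < 1 := by
  by_cases he : e ∈ (zdGraph 3).edgeSet
  · rw [param_of_mem he]
    by_cases hv : e ∈ vertBonds
    · rw [τPT_of_vert hv, Set.projIcc_of_mem _ (Set.Ioo_subset_Icc_self ht)]
      exact ht.2
    · rw [τPT_of_not_vert hv, Set.coe_projIcc]
      exact max_lt zero_lt_one (min_lt_iff.2 (Or.inr hp))
  · rw [param_of_not_mem he]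
    exact zero_lt_one

/-- **The vertical cylinder has positive probability for every `p < 1`, `t ∈ (0,1)`**: its open
bonds are vertical lattice edges (weight `t > 0`), all other pairs of `Λ_n` have weight
`1 − param > 0`. [folklore] -/
theorem real_localCylinder_pos {p t : ℝ} (hp : p < 1) (ht : t ∈ Set.Ioo (0 : ℝ) 1) (n : ℕ) :
    0 < (prodBernoulli (param p t)).real
      (localCylinder (↑((box 3 n).sym2) : Set (Sym2 (Site 3))) (Column.colT n)) := by
  rw [prodBernoulli_real_localCylinder]
  refine Finset.prod_pos fun e _ => ?_
  split_ifs with he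
  · obtain ⟨k, -, -, rfl⟩ := he
    rw [param_of_mem (Column.bond_mem_edgeSet k), τPT_of_vert (Column.isVert_bond k),
      Set.projIcc_of_mem _ (Set.Ioo_subset_Icc_self ht)]
    exact ht.1
  · exact sub_pos.2 (param_lt_one hp ht e)

/-- **Two-parameter Russo in the `t`-direction** (valid for every real `p`, and `t ∈ (0,1)`):
`∂_tΘ_n(p,t) = Σ_{e ∈ Λ_n.sym2, e vertical lattice edge} P_{(p,t)}(e pivotal)`. [folklore] -/
theorem hasDerivAt_ThetaBox_t (n : ℕ) (p : ℝ) {t : ℝ} (ht : t ∈ Set.Ioo (0 : ℝ) 1) :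
    HasDerivAt (fun s => ThetaBox n p s)
      (∑ e ∈ (box 3 n).sym2,
        wz e * (prodBernoulli (param p t)).real {ω | IsPivotal (siteToBoundary 3 n) e ω}) t := by
  classical
  have hfun : (fun s => ThetaBox n p s) =
      fun s => (prodBernoulli (param p s)).real (siteToBoundary 3 n) :=
    funext fun s => ThetaBox_eq n p s
  rw [hfun]
  refine hasDerivAt_prodBernoulli_real (fun s : ℝ => param p s) (isUpperSet_siteToBoundary 3 n)
    (determinedBy_siteToBoundary 3 n) t wz fun e _ => ?_
  by_cases he : e ∈ (zdGraph 3).edgeSet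
  · by_cases hv : e ∈ vertBonds
    · rw [wz_of_vert he hv]
      have heq : (fun s : ℝ => s) =ᶠ[𝓝 t] fun s : ℝ => (param p s e : ℝ) := by
        filter_upwards [Ioo_mem_nhds ht.1 ht.2] with s hs
        rw [param_of_mem he, τPT_of_vert hv, Set.projIcc_of_mem _ (Set.Ioo_subset_Icc_self hs)]
      exact (hasDerivAt_id t).congr_of_eventuallyEq heq.symm
    · rw [wz_of_not_vert hv]
      have hc : (fun s : ℝ => (param p s e : ℝ)) =
          fun _ => ((Set.projIcc (0 : ℝ) 1 zero_le_one p : unitInterval) : ℝ) := by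
        funext s
        rw [param_of_mem he, τPT_of_not_vert hv]
      rw [hc]
      exact hasDerivAt_const _ _
  · rw [wz_of_not_mem he]
    have hc : (fun s : ℝ => (param p s e : ℝ)) = fun _ => (0 : ℝ) := by
      funext s
      rw [param_of_not_mem he]
      rfl
    rw [hc]
    exact hasDerivAt_const _ _

/-- **`∂_tΘ_n(p,t) > 0` for `n ≥ 1`, `p < 1`, `t ∈ (0,1)`** — in particular on the whole
half-plane `{p ≤ 0}` where `∂_pΘ_n = 0`: the Russo sum is bounded below by the term of
`e_z = s(0, e₃)`, pivotal on the positive-probability vertical cylinder. The guard `1 ≤ n` is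
needed (`Θ_0 ≡ 1`, cf. `ModelFacts.Negative.DerivPosGuard`). [folklore] -/
theorem deriv_t_pos (n : ℕ) (hn : 1 ≤ n) {p : ℝ} (hp : p < 1) {t : ℝ} (ht : t ∈ Set.Ioo (0 : ℝ) 1) :
    0 < deriv (fun s => ThetaBox n p s) t := by
  rw [(hasDerivAt_ThetaBox_t n p ht).deriv]
  have hnn : ∀ e ∈ (box 3 n).sym2,
      0 ≤ wz e * (prodBernoulli (param p t)).real {ω | IsPivotal (siteToBoundary 3 n) e ω} :=
    fun e _ => mul_nonneg (wz_nonneg e) measureReal_nonneg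
  refine lt_of_lt_of_le ?_ (Finset.single_le_sum hnn (Column.ez_mem_sym2_box hn))
  rw [wz_of_vert Column.ez_mem_edgeSet Column.isVert_ez, one_mul]
  exact (real_localCylinder_pos hp ht n).trans_le
    (measureReal_mono (Column.localCylinder_subset_pivotal hn))

end Summit.CriticalPhenomena.PercolationContinuityZ3.Theorems.SubcritExchangeUniformity.Negative

end
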